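import Mathlib
import HarnessLib
import Summits.Ventures.LatticeQCDFlow.Exactness.IMHKernel

/-!
# LatticeQCDFlow / Exactness — A MEASURE-PRESERVING SHIFT IS NOT AN INVOLUTION: proposing `y = T(x)` for a `q`-preserving bijection `T`
# that is NOT its own inverse, with the plain importance ratio, is NOT exact (defect identity + a three-point witness)

HONEST FRAMING: exact (Metropolis-corrected) sampling algorithms for lattice gauge theory;
figures of merit are autocorrelation/cost numbers at stated couplings and volumes; no
continuum-physics claim.

Venture `LatticeQCDFlow` (cell pub-lqcd), topic `Exactness`, FANOUT row 30 (lean-1 GEN-43, part II: MOVES IN FLOW SPACE; the cautionary twin of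
`LatentReversibleProposals.involutionProposal_invariant`, where an INVOLUTIVE `q`-preserving move is shown exact).  NEW WORK of the cell over
`IMHKernel`; no definition is introduced, nothing is cited as a fact.  Printed counterparts NAMED ONLY: deterministic proposals must be involutions
(or be "lifted" with a direction variable: Gustafson 1998; Turitsyn–Chertkov–Vucelja 2011) — the lattice instance is a one-directional
shift ∕ rotation of the flow's noise or of the field by a lattice symmetry that does not commute with the weight.

## Setting (general measurable `Ω`; flow law `q`; weight `w > 0`; `π = w·q`; `T : Ω ≃ᵐ Ω` with `q.map T = q`)

THE SHIFT PROPOSAL, def-free: ANY kernel `K` with `K(x, B) = a(x, Tx)·1_B(Tx) + (1 − a(x, Tx))·1_B(x)`, `a(x, y) = min(1, w(y)/w(x))` (move to `Tx`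
if accepted, else stay).

## Results [all ours]

* **`shift_bind_apply_add` (DEFECT IDENTITY)**: for every measurable `B`,
  `(πK)(B) + ∫_B min(w, w∘T) dq = π(B) + ∫_B min(w∘T⁻¹, w) dq` — exact iff the forward and backward neighbour-minima have the same
  integrals on every set; for an INVOLUTION (`T⁻¹ = T`) the two terms coincide (`shift_invariant_of_involutive`), otherwise not in general.
* **`shift_not_invariant` (WITNESS)**: `Ω = Fin 3`, `q` uniform, `w = (1, 2, 3)`, `T = (+1)` the cyclic shift: EVERY kernel realising the
  shift proposal moves `π({1}) = 2/3` to `1/3` (`shift_bind_apply_one`) — grossly wrong, although `T` preserves `q` and every step passes a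
  Metropolis test (that the cyclic shift preserves the uniform law is immediate and not typed).  The repair is either an involutive move
  (reflection) or a direction bit (lifting), not typed here.
-/

namespace Summit.Ventures.LatticeQCDFlow.Exactness

open MeasureTheory ProbabilityTheory
open scoped ENNReal

variable {Ω : Type*} [MeasurableSpace Ω] {q : Measure Ω} {w : Ω → ℝ}

/-! ## §1 The defect identity -/

omit [MeasurableSpace Ω] in
/-- `w(x)·(1 − a(x, y)) = w(x) − min(w x, w y)`. [ours, bookkeeping] -/
theorem mul_one_sub_imhAccept (hw0 : ∀ x, 0 < w x) (x y : Ω) : w x * (1 - imhAccept w x y) = w x - min (w x) (w y) := by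
  rw [mul_sub, mul_one, mul_imhAccept hw0]

/-- **`(πK)(B)` FOR THE SHIFT PROPOSAL**: `(πK)(B) = ∫_B min(w(T⁻¹y), w(y)) q(dy) + ∫_B (w − min(w, w∘T)) dq` (change of variables by the
`q`-preserving `T` in the accepted part). [ours] -/
theorem shift_bind_apply (hw : Measurable w) (hw0 : ∀ x, 0 < w x) (T : Ω ≃ᵐ Ω) (hT : q.map T = q) (K : Kernel Ω Ω)
    (hK : ∀ (x : Ω) {B : Set Ω}, MeasurableSet B → K x B =
      imhAcceptE w x (T x) * B.indicator 1 (T x) + ENNReal.ofReal (1 - imhAccept w x (T x)) * B.indicator 1 x)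
    {B : Set Ω} (hB : MeasurableSet B) :
    ((q.withDensity fun y => ENNReal.ofReal (w y)).bind K) B =
      ∫⁻ y in B, ENNReal.ofReal (min (w (T.symm y)) (w y)) ∂q + ∫⁻ y in B, ENNReal.ofReal (w y - min (w y) (w (T y))) ∂q := by
  have hd : Measurable fun x => ENNReal.ofReal (w x) := hw.ennreal_ofReal
  have hmin : Measurable fun x => ENNReal.ofReal (min (w x) (w (T x))) := (hw.min (hw.comp T.measurable)).ennreal_ofReal
  have hmin' : Measurable fun y => ENNReal.ofReal (min (w (T.symm y)) (w y)) := ((hw.comp T.symm.measurable).min hw).ennreal_ofReal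
  have hrej : Measurable fun x => ENNReal.ofReal (w x - min (w x) (w (T x))) := (hw.sub (hw.min (hw.comp T.measurable))).ennreal_ofReal
  rw [Measure.bind_apply hB (Kernel.aemeasurable _), lintegral_withDensity_eq_lintegral_mul _ hd (Kernel.measurable_coe K hB)]
  simp only [Pi.mul_apply]
  have hpt : ∀ x, ENNReal.ofReal (w x) * K x B =
      B.indicator (fun y => ENNReal.ofReal (min (w (T.symm y)) (w y))) (T x) + B.indicator (fun x => ENNReal.ofReal (w x - min (w x) (w (T x)))) x := by
    intro x
    rw [hK x hB, mul_add, ← mul_assoc, ofReal_mul_imhAcceptE hw0, ← mul_assoc, ← ENNReal.ofReal_mul (hw0 x).le,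
      mul_one_sub_imhAccept hw0]
    congr 1
    · by_cases h : T x ∈ B
      · rw [Set.indicator_of_mem h, Set.indicator_of_mem h, Pi.one_apply, mul_one, T.symm_apply_apply]
      · rw [Set.indicator_of_notMem h, Set.indicator_of_notMem h, mul_zero]
    · by_cases h : x ∈ B
      · rw [Set.indicator_of_mem h, Set.indicator_of_mem h, Pi.one_apply, mul_one]
      · rw [Set.indicator_of_notMem h, Set.indicator_of_notMem h, mul_zero]
  simp_rw [hpt]
  rw [lintegral_add_right _ (hrej.indicator hB), lintegral_indicator hB]
  congr 1
  -- change of variables `y = T x` under `q.map T = q`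
  have h := lintegral_map_equiv (B.indicator fun y => ENNReal.ofReal (min (w (T.symm y)) (w y))) T (μ := q)
  rw [hT] at h
  rw [← h, lintegral_indicator hB]

/-- **`π(B)` SPLIT THE SAME WAY**: `∫_B (w − min(w, w∘T)) dq + ∫_B min(w, w∘T) dq = π(B)`. [ours, bookkeeping] -/
theorem shift_target_split (hw : Measurable w) (hw0 : ∀ x, 0 < w x) (T : Ω ≃ᵐ Ω) {B : Set Ω} (hB : MeasurableSet B) :
    ∫⁻ y in B, ENNReal.ofReal (w y - min (w y) (w (T y))) ∂q + ∫⁻ y in B, ENNReal.ofReal (min (w y) (w (T y))) ∂q =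
      (q.withDensity fun y => ENNReal.ofReal (w y)) B := by
  have hmin : Measurable fun x => ENNReal.ofReal (min (w x) (w (T x))) := (hw.min (hw.comp T.measurable)).ennreal_ofReal
  rw [withDensity_apply _ hB, ← lintegral_add_right _ hmin]
  refine lintegral_congr fun y => ?_
  rw [← ENNReal.ofReal_add (sub_nonneg.2 (min_le_left _ _)) (le_min (hw0 y).le (hw0 (T y)).le), sub_add_cancel]

/-- **THE DEFECT IDENTITY OF THE SHIFT PROPOSAL**: `(πK)(B) + ∫_B min(w, w∘T) dq = π(B) + ∫_B min(w∘T⁻¹, w) dq`. [ours] -/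
theorem shift_bind_apply_add (hw : Measurable w) (hw0 : ∀ x, 0 < w x) (T : Ω ≃ᵐ Ω) (hT : q.map T = q) (K : Kernel Ω Ω)
    (hK : ∀ (x : Ω) {B : Set Ω}, MeasurableSet B → K x B =
      imhAcceptE w x (T x) * B.indicator 1 (T x) + ENNReal.ofReal (1 - imhAccept w x (T x)) * B.indicator 1 x)
    {B : Set Ω} (hB : MeasurableSet B) :
    ((q.withDensity fun y => ENNReal.ofReal (w y)).bind K) B + ∫⁻ y in B, ENNReal.ofReal (min (w y) (w (T y))) ∂q =
      (q.withDensity fun y => ENNReal.ofReal (w y)) B + ∫⁻ y in B, ENNReal.ofReal (min (w (T.symm y)) (w y)) ∂q := by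
  rw [shift_bind_apply hw hw0 T hT K hK hB, ← shift_target_split hw hw0 T hB]
  ring

/-- **SHARPNESS: AN INVOLUTIVE SHIFT IS EXACT** (on sets of finite forward-minimum mass): if `T (T x) = x` for all `x` then `(πK)(B) = π(B)`. [ours] -/
theorem shift_bind_apply_eq_of_involutive (hw : Measurable w) (hw0 : ∀ x, 0 < w x) (T : Ω ≃ᵐ Ω) (hT : q.map T = q)
    (hTT : ∀ x, T (T x) = x) (K : Kernel Ω Ω)
    (hK : ∀ (x : Ω) {B : Set Ω}, MeasurableSet B → K x B =
      imhAcceptE w x (T x) * B.indicator 1 (T x) + ENNReal.ofReal (1 - imhAccept w x (T x)) * B.indicator 1 x)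
    {B : Set Ω} (hB : MeasurableSet B) (hfin : ∫⁻ y in B, ENNReal.ofReal (min (w y) (w (T y))) ∂q ≠ ⊤) :
    ((q.withDensity fun y => ENNReal.ofReal (w y)).bind K) B = (q.withDensity fun y => ENNReal.ofReal (w y)) B := by
  have h := shift_bind_apply_add hw hw0 T hT K hK hB
  have hsymm : ∀ y, T.symm y = T y := fun y => by
    rw [← hTT y, T.symm_apply_apply, hTT]
  simp_rw [hsymm, min_comm (w (T _)) (w _)] at h
  exact (ENNReal.add_left_inj hfin).1 h

/-! ## §2 The three-point witness: the cyclic shift of `Fin 3` -/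

section ShiftWitness

variable {q : Measure (Fin 3)} {w : Fin 3 → ℝ}

/-- **THE WITNESS, QUANTIFIED**: `q` uniform on `Fin 3`, `w = (1, 2, 3)`, `T = (+1)`: one shift step from `π` puts mass `1/3` on `{1}`
(target `2/3`). [ours] -/
theorem shift_bind_apply_one (hq : ∀ i, q {i} = ENNReal.ofReal 3⁻¹) (hw0 : w 0 = 1) (hw1 : w 1 = 2) (hw2 : w 2 = 3)
    (K : Kernel (Fin 3) (Fin 3))
    (hK : ∀ (x : Fin 3) {B : Set (Fin 3)}, MeasurableSet B → K x B =
      imhAcceptE w x (x + 1) * B.indicator 1 (x + 1) + ENNReal.ofReal (1 - imhAccept w x (x + 1)) * B.indicator 1 x) :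
    ((q.withDensity fun y => ENNReal.ofReal (w y)).bind K) {1} = ENNReal.ofReal 3⁻¹ ∧
      (q.withDensity fun y => ENNReal.ofReal (w y)) {1} = ENNReal.ofReal (2 / 3) := by
  have h01 : (0 : Fin 3) + 1 = 1 := rfl
  have h11 : (1 : Fin 3) + 1 = 2 := rfl
  have h21 : (2 : Fin 3) + 1 = 0 := rfl
  have hπ : ∀ i, (q.withDensity fun y => ENNReal.ofReal (w y)) {i} = ENNReal.ofReal (w i) * ENNReal.ofReal 3⁻¹ := fun i => by
    rw [withDensity_apply _ (measurableSet_singleton _), lintegral_singleton, hq]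
  have hK0 : K 0 {1} = 1 := by
    rw [hK 0 (measurableSet_singleton _), h01, Set.indicator_of_mem (Set.mem_singleton _),
      Set.indicator_of_notMem (by decide : (0 : Fin 3) ∉ ({1} : Set (Fin 3))), mul_zero, add_zero, Pi.one_apply, mul_one,
      imhAcceptE, imhAccept, hw0, hw1]
    norm_num
  have hK1 : K 1 {1} = 0 := by
    rw [hK 1 (measurableSet_singleton _), h11, Set.indicator_of_notMem (by decide : (2 : Fin 3) ∉ ({1} : Set (Fin 3))), mul_zero,
      zero_add, Set.indicator_of_mem (Set.mem_singleton _), Pi.one_apply, mul_one, imhAccept, hw1, hw2]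
    norm_num
  have hK2 : K 2 {1} = 0 := by
    rw [hK 2 (measurableSet_singleton _), h21, Set.indicator_of_notMem (by decide : (0 : Fin 3) ∉ ({1} : Set (Fin 3))),
      Set.indicator_of_notMem (by decide : (2 : Fin 3) ∉ ({1} : Set (Fin 3))), mul_zero, mul_zero, add_zero]
  constructor
  · rw [Measure.bind_apply (measurableSet_singleton _) (Kernel.aemeasurable _), lintegral_fintype, Fin.sum_univ_three,
      hK0, hK1, hK2, hπ 0, hw0, ENNReal.ofReal_one, one_mul, one_mul, zero_mul, zero_mul, add_zero, add_zero]
  · rw [hπ 1, hw1, ← ENNReal.ofReal_mul (by norm_num)]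
    norm_num

/-- **THE SHIFT PROPOSAL IS NOT EXACT**: on `Fin 3` with the uniform law and `w = (1, 2, 3)`, for EVERY kernel realising "propose `x + 1`,
accept with `min(1, w(x+1)/w(x))`", `π` is not invariant — although `x ↦ x + 1` preserves `q`. [ours] -/
theorem shift_not_invariant (hq : ∀ i, q {i} = ENNReal.ofReal 3⁻¹) (hw0 : w 0 = 1) (hw1 : w 1 = 2) (hw2 : w 2 = 3)
    (K : Kernel (Fin 3) (Fin 3))
    (hK : ∀ (x : Fin 3) {B : Set (Fin 3)}, MeasurableSet B → K x B =
      imhAcceptE w x (x + 1) * B.indicator 1 (x + 1) + ENNReal.ofReal (1 - imhAccept w x (x + 1)) * B.indicator 1 x) :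
    ¬ Kernel.Invariant K (q.withDensity fun y => ENNReal.ofReal (w y)) := by
  intro h
  obtain ⟨h1, h2⟩ := shift_bind_apply_one hq hw0 hw1 hw2 K hK
  have h3 := congrArg (fun μ : Measure (Fin 3) => μ {1}) h.def
  rw [h1, h2, ENNReal.ofReal_eq_ofReal_iff (by norm_num) (by norm_num)] at h3
  norm_num at h3

end ShiftWitness

end Summit.Ventures.LatticeQCDFlow.Exactness
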